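import Literature.NumberTheory.LFunctions.KowalskiMichelPeterssonFormula
import HarnessLib

/-!
# KMV 2000, Lemma 3.3: the off-diagonal Kloosterman–Bessel bound for pairs with `m₁m₂ ≪ q^{1−δ}` (NAMED FACT, dyadic
# form as printed; typed ≠ proved)

LANDING NOTE (typer ls-idea-typ-1 gen 2, cell ls-idea): typing want W-L17-1 of seat ls-idea-lens-17 (regen g0), the
seat's `Sketch_L17_Lemma33.lean` v2 sha16 74cd40246d1a1448 after critic E's RULING T1 (REF-E b6/b6.1: PASS; the KMV
cite sits ONLY on the dyadic statement). This Literature file carries the PRINTED fact `kmv2000_lemma33_dyadic`, the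
box sum `offDiagBoxSum` in tree vocabulary (`KowalskiMichel2000.petJ`) and the range bookkeeping
`collar_product_range`; the strictly stronger BOX reading (not KMV's words; expected from [VdK2]/[I-S], acq-13804 /
acq-11417) is typed Summits-side as an UNCITED hypothesis shape next to the line's split deck
(`PrimeLevelFamEdgeIdeaDeltasPairsSplitLemma33.lean`), per the ruling «a named fact may not exceed its print».
Original sketch header follows.


Planner `ls-idea-lens-17` (regen g0), 2026-08-28. This is the NAMED INPUT of stub 2 (`stub_pairsBelow`,
`SubPairs` below the cut) of the registered line `Cruxes/MomentsBeyondDiagonal/Lines/pairs_beyond_family_size.lean`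
on K_A = `PrimeLevelFamEdge.MomentsBeyondDiagonal` (stmt-Parity-20007); it is cited in four tree docstrings
(`KMVMomentAsymptoticsBeyondDiagonal.lean` l.14/26/38, `KMVHighDerivativeNonvanishing.lean` l.50/188) but NOT typed
(`rg -i lemma33` over `Literature/NumberTheory/LFunctions` = 0 declarations, 2026-08-28T06:40Z).

PRINTED [paper:doi-10-1515-crll-2000-074 = KowalskiMichelVanderKam2000, Lemma 3.3 p. 8 L77–L104; p. 9 L1–L3]:
«Lemma 3.3 Let N₁, N₂, m₁, m₂ be such that N₁N₂ ≪ q(log q)², m₁m₂ ≪ q^{1−δ} for some δ > 0. Then for all ε > 0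
  Σ_{n₁∼N₁, n₂∼N₂} Σ_{c≥1} S(m₁n₁, m₂n₂; cq)/(cq) · J₁(4π√(m₁n₁m₂n₂)/(cq)) ≪_{ε,δ} q^ε (m₁m₂N₁N₂)^{1/2}/q .
For comparison, using the Weil bound alone gives q^{−1/2+ε}(m₁m₂N₁N₂)^{1/2} here. Lemma 3.3 allows one to take any
Δ < 1» («One can show (see [VdK2] for details)»; applied p. 13 L79–L84: «Integrating by parts and using Lemma 3.3,
one shows (see [I-S] or [VdK2] for details) that the terms coming from the Kloosterman sums have a total contribution
which is ≪ q̂^{1−γ} for som[e] γ = γ(Δ) > 0 if Δ < 1»). Proof sources [VdK2] (VanderKam, J. London Math. Soc. 61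
(2000)) and [I-S] (Iwaniec–Sarnak 2000; acq-11417) are NOT held — typed ≠ proved, located ≠ endorsed.

VOCABULARY (tree): the inner `c`-sum is Kowalski–Michel's `J(l₁,l₂)` up to the factor `2π`:
`KowalskiMichel2000.petJ q l₁ l₂ = (2π/q) Σ'_{r ≥ 1} r⁻¹ S(l₁,l₂;qr) J₁(4π√(l₁l₂)/(qr)) = 2π · Σ_{c≥1} S(l₁,l₂;cq)/(cq) J₁(…)`
(`KowalskiMichelPeterssonFormula.lean`; its absolute convergence for `l₁,l₂ ≥ 1` is part of the named fact
`kowalskiMichel2000_peterssonFormula`), so the printed left side is `(2π)⁻¹ Σ_{n₁,n₂} petJ q (m₁n₁) (m₂n₂)` and the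
`2π` is absorbed in the constant.

TYPING DECISIONS, v2 after critic E's RULING T1 (REF-E b6, 2026-08-28T06:50:07Z: «n ∼ N is DYADIC in print; the BOX reading
is strictly STRONGER and not recoverable from dyadic totals ⇒ the decl carrying the KMV cite must be the dyadic one; the box
(or smooth-weight) form is a SEPARATE Prop … never KMV's words (a named fact may not exceed its print)»): (T1) the NAMED FACT
AS PRINTED is `kmv2000_lemma33_dyadic` (`n ∼ N` = `N < n ≤ 2N`); the BOX form `kmv2000_lemma33_box` (all sub-boxes
`N < n ≤ N' ≤ 2N` — the integration-by-parts-ready reading the p. 13 application needs, since partial summation against the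
smooth weights `W(n₁n₂/q̂²)(log …)^k/√(n₁n₂)` requires all initial segments of a dyadic block) is a SEPARATE Prop, NOT KMV's
words: «reading needed for the p. 13 partial summation; expected from [VdK2] (acq-13804, not held) / [I-S] (acq-11417);
confirm on arrival». `lemma33_dyadic_of_box` (proved) records box ⇒ dyadic; the converse is not claimed. (T2) the two «≪» in the
HYPOTHESES get an explicit constant `A > 0` on which `C` may depend. (T3) `q` prime (the paper's standing assumption,
§1), `m₁, m₂ ≥ 1`, `N₁, N₂ ≥ 1`. (T4) No smooth-weight version is typed here (that is what [I-S]/IS 2000 prove; type it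
from the source when acq-11417 lands). Typing checklist 4c: no Bochner integral (the `tsum` inside `petJ` is covered by
the Petersson named fact's `Summable` clause for arguments `≥ 1`), no hand-picked threshold, hypotheses satisfiable
(`N₁ = N₂ = 1`, `m₁ = m₂ = 1` gives an empty or one-term box; the one-term case is consistent with the trivial bound
`J(l₁,l₂) ≪ (l₁l₂)^{1/2+ε} q^{−3/2}` of p. 312, which is SMALLER than the claim by `q^{−1/2+2ε}`).
Nothing here is proved about moments; no summit statement is proved by this seat.
-/

namespace Literature.NumberTheory.LFunctions.KMV2000

open KowalskiMichel2000 (petJ)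

noncomputable section

/-- The box Kloosterman–Bessel sum of KMV Lemma 3.3 in tree vocabulary:
`Σ_{N₁ < n₁ ≤ N₁'} Σ_{N₂ < n₂ ≤ N₂'} J(m₁n₁, m₂n₂)` (`= 2π ×` the printed double sum over the box). [cite: KowalskiMichelVanderKam2000, Lemma 3.3 p. 8 (the double sum, via `J` of KowalskiMichel2000 §2.4.2)] -/
def offDiagBoxSum (q : ℕ) [NeZero q] (m₁ m₂ : ℕ) (N₁ N₁' N₂ N₂' : ℝ) : ℂ :=
  ∑ n₁ ∈ Finset.Ioc ⌊N₁⌋₊ ⌊N₁'⌋₊, ∑ n₂ ∈ Finset.Ioc ⌊N₂⌋₊ ⌊N₂'⌋₊, petJ q (m₁ * n₁) (m₂ * n₂)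

/-- **KMV 2000, Lemma 3.3 (p. 8) — THE NAMED FACT AS PRINTED** (`n ∼ N` = `N < n ≤ 2N`; (T2) explicit constant `A`
in the two «≪» hypotheses, (T3) `q` prime, `mᵢ, Nᵢ ≥ 1`): for every `δ > 0`, `ε > 0`, `A > 0` there is `C = C(δ, ε, A)`
such that for every prime `q`, all `N₁, N₂ ≥ 1` with `N₁N₂ ≤ A q (log q)²` and all `m₁, m₂ ≥ 1` with `m₁m₂ ≤ A q^{1−δ}`:
`‖Σ_{N₁<n₁≤2N₁} Σ_{N₂<n₂≤2N₂} J(m₁n₁, m₂n₂)‖ ≤ C q^{ε−1} (m₁m₂N₁N₂)^{1/2}` (`J` = `KowalskiMichel2000.petJ` = `2π ×` the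
printed `c`-sum). «One can show (see [VdK2] for details)» — proof not in the paper; typed ≠ proved.
[cite: KowalskiMichelVanderKam2000, Lemma 3.3 p. 8] -/
def kmv2000_lemma33_dyadic : Prop :=
  ∀ δ : ℝ, 0 < δ → ∀ ε : ℝ, 0 < ε → ∀ A : ℝ, 0 < A → ∃ C : ℝ,
    ∀ (q : ℕ) [NeZero q], q.Prime →
    ∀ N₁ N₂ : ℝ, 1 ≤ N₁ → 1 ≤ N₂ → N₁ * N₂ ≤ A * q * Real.log q ^ 2 →
    ∀ m₁ m₂ : ℕ, 1 ≤ m₁ → 1 ≤ m₂ → ((m₁ * m₂ : ℕ) : ℝ) ≤ A * (q : ℝ) ^ (1 - δ) →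
      ‖offDiagBoxSum q m₁ m₂ N₁ (2 * N₁) N₂ (2 * N₂)‖ ≤
        C * (q : ℝ) ^ (ε - 1) * Real.sqrt (((m₁ * m₂ : ℕ) : ℝ) * N₁ * N₂)

/-- Range bookkeeping for the p. 13 application (used by stub 2 of the registered line on
`PrimeLevelFamEdge.MomentsBeyondDiagonal`, collar instance): a pair below the collar has `m₁m₂ < q̂^{2(1−ε)} = (q/(4π²))^{1−ε} ≤ q^{1−ε}`, i.e. satisfies Lemma 3.3's product
hypothesis with `δ = ε`, `A = 1`. Stated over reals: `ε ≤ 1`, `1 ≤ q`.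
[cite: KowalskiMichelVanderKam2000, p. 13 L79–L84 (range of application of Lemma 3.3, `Δ < 1`)] -/
theorem collar_product_range {ε : ℝ} (hε1 : ε ≤ 1) {q : ℝ} (hq : 1 ≤ q) {x : ℝ}
    (hx : x ≤ (q / (4 * Real.pi ^ 2)) ^ (1 - ε)) : x ≤ q ^ (1 - ε) := by
  have hπ : 1 ≤ 4 * Real.pi ^ 2 := by nlinarith [Real.pi_gt_three]
  have h0 : 0 ≤ q / (4 * Real.pi ^ 2) := by positivity
  have h1 : q / (4 * Real.pi ^ 2) ≤ q := div_le_self (by linarith) hπ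
  exact hx.trans (Real.rpow_le_rpow h0 h1 (by linarith))

end

end Literature.NumberTheory.LFunctions.KMV2000
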